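import Mathlib
import Summits.ResolutionOfSingularities.ResolutionOfSingularities.Theorems.RadicialJungCleanModelsContactChainContaining
import HarnessLib

/-!
# Route `RadicialJung`, crux `CleanModels` (stmt-ResolutionOfSingularities-15917), line `Sketch` rev 35, stub 6 `stub_cleanProp44` (X44c),
# work plan O8 / L7b: the UNCHARGED landing — exit-or-`p`-th-power dichotomy, and the form (2) exit

After `…ContactChainFamily.lean` (✓ p812153) and `…ContactChainContaining.lean` (✓ p812266) the only landing of a chain of point blowing
ups following the curve that is not clean-permissible outright is the UNCHARGED one.  This file states it exactly:

* `cleanPermissibleAt_or_uncharged_of_pointChain` — at the end point `x` of a chain of `n ≥ max_i k_i` point blowing ups, for a representative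
  presented at `x₀` as `u₀ · t₁^{α₁} t₂^{α₂} · ∏_i (γ_i w^{k_i} + s₀ᵢ)^{a_i}` (containing pair + transversal family): EITHER the line of `σ^♯ G` is
  clean-permissible for the strict transform `C` at `x`, OR `p ∣ α₁, α₂`, `p ∣ n(α₁+α₂) + Σ k_i a_i` and the representative reads `U · q^p` at
  `x` with `U` a unit and `q ≠ 0` (the «uncharged landing»; what happens next is the restart of memo 4e §2.4–2.6, (B′)/(B5′)).
* `cleanPermissibleAt_of_unit_mul_pow` — the form (2) exit at an uncharged landing: a representative `f(u · q^p)` with `u` a unit whose residue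
  is not a `p`-th power is, after rescaling the coefficients by `f(q)⁻¹`, the unit representative of ✓ `cleanPermissibleAt_of_unit`.

Honest framing: OURS (elementary); nothing here proves resolution in characteristic `p`, X44c, or any case of `CleanModels`.
-/

noncomputable section

set_option linter.dupNamespace false -- mandated namespace of this single-conjunct summit

open CategoryTheory AlgebraicGeometry TopologicalSpace IsLocalRing
open Literature.AlgebraicGeometry.Resolution Literature.AlgebraicGeometry.Motives
open Scheme.IdealSheafData

universe u

namespace Summit.ResolutionOfSingularities.ResolutionOfSingularities.Theorems.RadicialJung.CleanModels

/-- **Form (2) exit at an uncharged landing.**  If a non-trivial representative of the `F^p`-line of `G` reads `f(u · q^p)` at the regular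
local ring `R` (`f : R → F` injective into a field, `q ≠ 0`) with `u` a unit whose residue is not a `p`-th power, then the line is
clean-permissible at `R` for every `J` with `R/J` regular: rescale the coefficients by `f(q)⁻¹` and apply `cleanPermissibleAt_of_unit`.
[cite: Matsumura1987, Thm. 14.2] -/
theorem cleanPermissibleAt_of_unit_mul_pow {R F : Type u} [CommRing R] [IsRegularLocalRing R] [Field F] (p : ℕ) (f : R →+* F)
    (hf : Function.Injective f) (G : F) (J : Ideal R) [IsRegularLocalRing (R ⧸ J)] (cc : Fin p → F)
    (hcc : ∃ j : Fin p, (j : ℕ) ≠ 0 ∧ cc j ≠ 0) (u q : R) (hu : IsUnit u) (hq : q ≠ 0)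
    (hX : (∑ j : Fin p, cc j ^ p * G ^ (j : ℕ)) = f (u * q ^ p)) (hup : ∀ c' : R, u - c' ^ p ∉ maximalIdeal R) :
    CleanPermissibleAt p f G J := by
  have hfq : f q ≠ 0 := fun h => hq (hf (by rw [h, map_zero]))
  refine cleanPermissibleAt_of_unit p f G J (fun j => cc j * (f q)⁻¹) ?_ u hu ?_ hup
  · obtain ⟨j, hj, hj0⟩ := hcc
    exact ⟨j, hj, mul_ne_zero hj0 (inv_ne_zero hfq)⟩
  · calc (∑ j : Fin p, (cc j * (f q)⁻¹) ^ p * G ^ (j : ℕ))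
        = (∑ j : Fin p, cc j ^ p * G ^ (j : ℕ)) * ((f q)⁻¹) ^ p := by
          rw [Finset.sum_mul]
          exact Finset.sum_congr rfl fun j _ => by ring
      _ = f (u * q ^ p) * ((f q)⁻¹) ^ p := by rw [hX]
      _ = f u := by
          rw [map_mul, map_pow, mul_assoc, ← mul_pow, mul_inv_cancel₀ hfq, one_pow, mul_one]

/-- **Exit or uncharged landing.**  See the module docstring. [cite: CossartJannsenSaito2020, proof of Thm. 6.28, Step 5]
[cite: CossartPiltant2008, Prop. 4.4 (proof, p. 10)] -/
theorem cleanPermissibleAt_or_uncharged_of_pointChain {X₀ X : Scheme.{u}} [IsIntegral X₀] [IsIntegral X] {σ : X ⟶ X₀}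
    [IsDominant σ] {C₀ : Closeds X₀} {C : Closeds X} {x : X} {n : ℕ} (h : IsPointChainAlong σ C₀ C x n)
    [IsLocallyNoetherian X₀] [IsLocallyNoetherian X] (hX₀ : Scheme.IsRegular X₀)
    (hC₀reg : ∀ y ∈ (C₀ : Set X₀), ∃ c : Fin 2 → X₀.presheaf.stalk y,
      IsRsopPart c ∧ Ideal.span (Set.range c) = stalkIdeal (vanishingIdeal C₀) y)
    (hxC₀ : σ x ∈ (C₀ : Set X₀)) (hdim₀ : ringKrullDim (X₀.presheaf.stalk (σ x)) = 3)
    (p : ℕ) (G : X₀.functionField) (cc : Fin p → X₀.functionField) (hcc : ∃ j : Fin p, (j : ℕ) ≠ 0 ∧ cc j ≠ 0)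
    (w u₀ : X₀.presheaf.stalk (σ x)) (hw : stalkIdeal (vanishingIdeal C₀) (σ x) ⊔ Ideal.span {w} = maximalIdeal _)
    (hu₀ : IsUnit u₀) (t : Fin 2 → X₀.presheaf.stalk (σ x)) (ht : IsRsopPart t)
    (htP : Ideal.span (Set.range t) = stalkIdeal (vanishingIdeal C₀) (σ x)) (α : Fin 2 → ℕ)
    {m : ℕ} (γ s₀ : Fin m → X₀.presheaf.stalk (σ x)) (hγ : ∀ i, IsUnit (γ i))
    (hs₀ : ∀ i, s₀ i ∈ stalkIdeal (vanishingIdeal C₀) (σ x)) (k a : Fin m → ℕ) (hkn : ∀ i, k i ≤ n)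
    (hX : (∑ j : Fin p, cc j ^ p * G ^ (j : ℕ)) =
      RatFn.toFunctionField (σ x) (u₀ * (∏ j, t j ^ α j) * ∏ i, (γ i * w ^ k i + s₀ i) ^ a i)) :
    CleanPermissibleAt p (RatFn.toFunctionField x) (RatFn.functionFieldMap σ G) (stalkIdeal (vanishingIdeal C) x) ∨
      ((∀ j, p ∣ α j) ∧ p ∣ (n * ∑ j, α j + ∑ i, k i * a i) ∧
        ∃ (U q : X.presheaf.stalk x), IsUnit U ∧ q ≠ 0 ∧
          (∑ j : Fin p, (RatFn.functionFieldMap σ (cc j)) ^ p * (RatFn.functionFieldMap σ G) ^ (j : ℕ)) =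
            RatFn.toFunctionField x (U * q ^ p)) := by
  classical
  by_cases hch : (∃ j, ¬ p ∣ α j) ∨ ¬ p ∣ (n * ∑ j, α j + ∑ i, k i * a i)
  · exact Or.inl (cleanPermissibleAt_of_pointChain_containing h hX₀ hC₀reg hxC₀ hdim₀ p G cc hcc w u₀ hw hu₀ t ht htP α γ s₀ hγ hs₀
      k a hkn hch hX)
  push Not at hch
  obtain ⟨hα, hN⟩ := hch
  refine Or.inr ⟨hα, hN, ?_⟩
  obtain ⟨hXreg, hCreg, hxC, hdim, e, he, ⟨tn, htn, htnP, htimg⟩, hfam⟩ :=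
    contact_family_pair_along_pointChain h hX₀ hC₀reg hxC₀ hdim₀ w hw t ht htP γ s₀ hγ hs₀ k
  -- the local rings at `x`
  haveI : IsRegularLocalRing (X.presheaf.stalk x) := hXreg x
  haveI := isDomain_of_isRegularLocalRing (X.presheaf.stalk x)
  haveI : IsRegularLocalRing (X.presheaf.stalk x ⧸ stalkIdeal (vanishingIdeal C) x) := by
    rw [← htnP]; exact htn.isRegularLocalRing_quotient
  have hP1 : ringKrullDim (X.presheaf.stalk x ⧸ stalkIdeal (vanishingIdeal C) x) = 1 := by
    rw [← htnP]; exact ringKrullDim_quotient_span_pair_eq_one htn hdim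
  have hPle : stalkIdeal (vanishingIdeal C) x ≤ maximalIdeal _ := le_sup_left.trans he.le
  -- `e ≠ 0`: its image is a regular parameter of the one-dimensional regular ring `𝒪_{X,x}/𝓘_{C,x}`
  have he0 : e ≠ 0 := by
    intro he0
    have hb := isRsopPart_quotient_singleton_of_sup_span_eq (stalkIdeal (vanishingIdeal C) x) hP1 e he
    have := hb.ne_zero 0
    simp [he0] at this
  -- per transversal member: `σ^#(s_i) = e^{k_i} · W_i` with `W_i` a unit
  choose c γ' π' hc hγ' hπ' hsimg using hfam
  have hW : ∀ i, IsUnit (c i * (γ' i + π' i)) := by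
    intro i
    refine (hc i).mul ?_
    by_contra hnu
    have hm : γ' i + π' i ∈ maximalIdeal (X.presheaf.stalk x) := (mem_maximalIdeal _).mpr hnu
    have h2 : γ' i + π' i - π' i ∈ maximalIdeal (X.presheaf.stalk x) := Ideal.sub_mem _ hm (hPle (hπ' i))
    rw [add_sub_cancel_right] at h2
    exact (mem_maximalIdeal _).mp h2 (hγ' i)
  have hsimg' : ∀ i, (σ.stalkMap x).hom (γ i * w ^ k i + s₀ i) = (c i * (γ' i + π' i)) * e ^ k i := by
    intro i
    rw [hsimg i, Nat.min_eq_right (hkn i), Nat.sub_eq_zero_of_le (hkn i), pow_zero, mul_one]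
    ring
  -- per containing member: `σ^#(t_j) = d_j · e^n · tn_j`
  choose d hd htimg' using htimg
  -- the unit `U`, the exponent `N`, and the `p`-th root `q` of the monomial part
  set N : ℕ := n * ∑ j, α j + ∑ i, k i * a i with hNdef
  set U : X.presheaf.stalk x := (σ.stalkMap x).hom u₀ * (∏ j, d j ^ α j) * ∏ i, (c i * (γ' i + π' i)) ^ a i with hU
  have hUunit : IsUnit U :=
    ((hu₀.map _).mul (IsUnit.prod_univ_iff.mpr fun j => (hd j).pow _)).mul
      (IsUnit.prod_univ_iff.mpr fun i => (hW i).pow _)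
  set q : X.presheaf.stalk x := (∏ j, tn j ^ (α j / p)) * e ^ (N / p) with hq
  have hq0 : q ≠ 0 :=
    mul_ne_zero (Finset.prod_ne_zero_iff.mpr fun j _ => pow_ne_zero _ (htn.ne_zero j)) (pow_ne_zero _ he0)
  have himg : (σ.stalkMap x).hom (u₀ * (∏ j, t j ^ α j) * ∏ i, (γ i * w ^ k i + s₀ i) ^ a i) =
      U * (∏ j, tn j ^ α j) * e ^ N := by
    rw [map_mul, map_mul, map_prod, map_prod]
    simp only [map_pow, hsimg', htimg', mul_pow, ← pow_mul, Finset.prod_mul_distrib, Finset.prod_pow_eq_pow_sum, hU, hNdef,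
      ← Finset.mul_sum, pow_add]
    ring
  have hmono : (∏ j, tn j ^ α j) * e ^ N = q ^ p := by
    rw [hq, mul_pow, ← Finset.prod_pow]
    congr 1
    · refine Finset.prod_congr rfl fun j _ => ?_
      rw [← pow_mul, Nat.div_mul_cancel (hα j)]
    · rw [← pow_mul, Nat.div_mul_cancel hN]
  refine ⟨U, q, hUunit, hq0, ?_⟩
  calc (∑ j : Fin p, (RatFn.functionFieldMap σ (cc j)) ^ p * (RatFn.functionFieldMap σ G) ^ (j : ℕ))
      = RatFn.functionFieldMap σ (∑ j : Fin p, cc j ^ p * G ^ (j : ℕ)) := by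
        rw [map_sum]; simp only [map_mul, map_pow]
    _ = RatFn.functionFieldMap σ (RatFn.toFunctionField (σ x) (u₀ * (∏ j, t j ^ α j) * ∏ i, (γ i * w ^ k i + s₀ i) ^ a i)) := by
        rw [hX]
    _ = RatFn.toFunctionField x ((σ.stalkMap x) (u₀ * (∏ j, t j ^ α j) * ∏ i, (γ i * w ^ k i + s₀ i) ^ a i)) :=
        RatFn.functionFieldMap_toFunctionField σ x _
    _ = RatFn.toFunctionField x (U * (∏ j, tn j ^ α j) * e ^ N) := congrArg (RatFn.toFunctionField x) himg
    _ = RatFn.toFunctionField x (U * q ^ p) := by rw [mul_assoc, hmono]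

end Summit.ResolutionOfSingularities.ResolutionOfSingularities.Theorems.RadicialJung.CleanModels

end
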